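import Summits.AnomalousDissipation.AnomalousDissipation.Theorems.PumpedMirrorMirrorFloorTGSmallEnergy

/-!
# The sharp Reynolds-stress bound for the Taylor–Green force: `|I_{f_TG}(u)| ≤ 2π |u|²`

Line `registered` of the crux `PumpedMirror.MirrorFloorTG` (stmt-AnomalousDissipation-15372), lead
`prover-line-stmt-AnomalousDissipation-15372-c2-0` (continuation c2, 2026-08-17); supports the crux (it is the engine of
`PumpedMirrorMirrorFloorTGExplicitEnergy.lean`, which settles the crux verbatim below the explicit level `1/(8π)`).

* §1 `tg_mixed_sq_le`, `tg_half_form_abs_le`, `tg_quadratic_form_abs_le` — the nine-variable inequality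
  `|c₀c₁c₂(v₀² − v₁²) − s₀c₁s₂v₀v₂ + c₀s₁s₂v₁v₂| ≤ |v|²` for unit vectors `(cᵢ,sᵢ)` (split
  `c₁v₀(c₀c₂v₀ − s₀s₂v₂) − c₀v₁(c₁c₂v₁ − s₁s₂v₂)`, Cauchy–Schwarz `(c₀c₂v₀ − s₀s₂v₂)² ≤ v₀² + v₂²` as an explicit
  sum of squares, AM–GM).
* §2 `partialDeriv_tgForce_coord`, `partialDeriv_tgForce_00 … _21`, `partialDeriv_tgForce_j2` — the gradient of
  `f_TG = (sin cos cos, −cos sin cos, 0)` entry by entry (shell sums over `{±1}³`, as in MirrorVariety's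
  `Negative/Anatomy`).
* §3 `inner_fderiv_tgForce_apply`, `abs_inner_fderiv_tgForce_apply_le` — the quadratic form
  `⟪∇f_TG(x)v, v⟫ = 2π(c₀c₁c₂(v₀² − v₁²) − s₀c₁s₂v₀v₂ + c₀s₁s₂v₁v₂)` and the pointwise bound `≤ 2π|v|²`
  (`2π = max_x ‖Def f_TG(x)‖_op`, attained at the eight stagnation points `xᵢ ∈ {0, ½}`).
* §4 `abs_inertialPairing_tgForce_le`, `abs_inertialPairing_tgForce_le_energy` — `|I_{f_TG}(u)| ≤ 2π‖u‖²` for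
  every `u ∈ L²(T³;ℝ³)` (no symmetry or incompressibility used; optimal in `L²` and inside the mirror class, by
  concentration next to a stagnation point). It replaces the non-explicit `C_TG = sup_x Σᵢ‖∂ᵢf_TG(x)‖ (≤ 6√2π)` of
  `exists_abs_inertialPairing_tg_le` (p146438).

References: Brachet et al., J. Fluid Mech. 130 (1983) §2 (Taylor–Green symmetries, stagnation points);
Foias–Manley–Rosa–Temam 2001, Ch. IV (1.7)–(1.9) (the trilinear form).
-/

noncomputable section

-- `Summit.<Summit>.<Problem>` is the tree's mandated summit-side namespace (CONVENTIONS §2); for this single-conjunct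
-- summit the two coincide, so the duplicate namespace component is deliberate.
set_option linter.dupNamespace false

namespace Summit.AnomalousDissipation.AnomalousDissipation.Theorems.PumpedMirrorMirrorFloorTG

open MeasureTheory Filter Topology UnitAddTorus
open scoped InnerProductSpace RealInnerProductSpace ENNReal NNReal ComplexConjugate
open Literature.Analysis.FunctionSpaces Literature.Analysis.FunctionSpaces.Torus Literature.Analysis.FluidPDE
open Summit.AnomalousDissipation.AnomalousDissipation.Theses.PumpedMirror
open Summit.AnomalousDissipation.AnomalousDissipation.Theorems.TaylorGreenLoudGalerkinStates.Negative
  (tgForce tgShell tgCoeff tgForce_eq_realTrigPoly isSmooth_tgForce isDivFree_tgForce hasZeroMean_tgForce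
    integral_norm_sq_tgForce continuous_tgForce sum_tgShell_prod mFourier_three)
open Summit.AnomalousDissipation.AnomalousDissipation.Theorems.TaylorCertificatesFloorCertificate
  (eigenforce_exists_workTest eigenforce_nsGeneratorPairing_self)

/-! ## §1 The algebraic heart: `|u·∇f_TG(x)u| ≤ 2π|u|²` as an inequality in nine real variables -/

/-- Cauchy–Schwarz with two unit vectors `(c₀,s₀)`, `(c₂,s₂)`:
`(c₀c₂v₀ − s₀s₂v₂)² ≤ v₀² + v₂²` (an explicit sum of squares). [folklore] -/
theorem tg_mixed_sq_le (c0 s0 c2 s2 v0 v2 : ℝ) (h0 : c0 ^ 2 + s0 ^ 2 = 1) (h2 : c2 ^ 2 + s2 ^ 2 = 1) :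
    (c0 * c2 * v0 - s0 * s2 * v2) ^ 2 ≤ v0 ^ 2 + v2 ^ 2 := by
  have key : v0 ^ 2 + v2 ^ 2 - (c0 * c2 * v0 - s0 * s2 * v2) ^ 2 =
      (c0 * c2 * v2 + s0 * s2 * v0) ^ 2 + c0 ^ 2 * s2 ^ 2 * (v0 ^ 2 + v2 ^ 2) +
        s0 ^ 2 * c2 ^ 2 * (v0 ^ 2 + v2 ^ 2) := by
    linear_combination (-(v0 ^ 2 + v2 ^ 2)) * h0 + (-(v0 ^ 2 + v2 ^ 2) * (c0 ^ 2 + s0 ^ 2)) * h2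
  have hnn : 0 ≤ v0 ^ 2 + v2 ^ 2 - (c0 * c2 * v0 - s0 * s2 * v2) ^ 2 := by rw [key]; positivity
  linarith

/-- One half of the quadratic form: `|c₁ v₀ (c₀c₂v₀ − s₀s₂v₂)| ≤ v₀² + v₂²/2`. [folklore] -/
theorem tg_half_form_abs_le (c0 s0 c1 s1 c2 s2 v0 v2 : ℝ) (h0 : c0 ^ 2 + s0 ^ 2 = 1)
    (h1 : c1 ^ 2 + s1 ^ 2 = 1) (h2 : c2 ^ 2 + s2 ^ 2 = 1) :
    |c1 * (v0 * (c0 * c2 * v0 - s0 * s2 * v2))| ≤ v0 ^ 2 + v2 ^ 2 / 2 := by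
  set W := c0 * c2 * v0 - s0 * s2 * v2 with hW
  have hWsq : W ^ 2 ≤ v0 ^ 2 + v2 ^ 2 := tg_mixed_sq_le c0 s0 c2 s2 v0 v2 h0 h2
  have hc1 : |c1| ≤ 1 := by
    rw [abs_le]
    constructor <;> nlinarith [sq_nonneg s1, sq_nonneg (c1 - 1), sq_nonneg (c1 + 1)]
  have hvW : |v0 * W| ≤ v0 ^ 2 + v2 ^ 2 / 2 := by
    rw [abs_le]
    constructor <;> nlinarith [sq_nonneg (v0 - W), sq_nonneg (v0 + W)]
  rw [abs_mul]
  calc |c1| * |v0 * W| ≤ 1 * |v0 * W| := mul_le_mul_of_nonneg_right hc1 (abs_nonneg _)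
    _ = |v0 * W| := one_mul _
    _ ≤ v0 ^ 2 + v2 ^ 2 / 2 := hvW

/-- **The nine-variable inequality.** For three unit vectors `(cᵢ, sᵢ)` (the cosines and sines of the three
coordinates) and every `v ∈ ℝ³`:
`|c₀c₁c₂(v₀² − v₁²) − s₀c₁s₂ v₀v₂ + c₀s₁s₂ v₁v₂| ≤ v₀² + v₁² + v₂²` — the normalised quadratic form
`u·∇f_TG(x)u / (2π)` is bounded by `|u|²` (sharp: equality in the limit at the stagnation points). [folklore] -/
theorem tg_quadratic_form_abs_le (c0 s0 c1 s1 c2 s2 v0 v1 v2 : ℝ) (h0 : c0 ^ 2 + s0 ^ 2 = 1)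
    (h1 : c1 ^ 2 + s1 ^ 2 = 1) (h2 : c2 ^ 2 + s2 ^ 2 = 1) :
    |c0 * c1 * c2 * (v0 ^ 2 - v1 ^ 2) - s0 * c1 * s2 * v0 * v2 + c0 * s1 * s2 * v1 * v2| ≤
      v0 ^ 2 + v1 ^ 2 + v2 ^ 2 := by
  have hA := tg_half_form_abs_le c0 s0 c1 s1 c2 s2 v0 v2 h0 h1 h2
  have hB := tg_half_form_abs_le c1 s1 c0 s0 c2 s2 v1 v2 h1 h0 h2
  have hsplit : c0 * c1 * c2 * (v0 ^ 2 - v1 ^ 2) - s0 * c1 * s2 * v0 * v2 + c0 * s1 * s2 * v1 * v2 =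
      c1 * (v0 * (c0 * c2 * v0 - s0 * s2 * v2)) - c0 * (v1 * (c1 * c2 * v1 - s1 * s2 * v2)) := by ring
  rw [hsplit]
  refine (abs_sub _ _).trans ?_
  linarith

/-! ## §2 The gradient of `f_TG`, entry by entry -/

/-- Coordinates of the partial derivatives of `f_TG` as sums over the TG shell:
`∂ⱼ(f_TG)ᵢ(x) = Re Σ_{shell} e_k(x) (2πi kⱼ) f̂(k)ᵢ`. [folklore] -/
theorem partialDeriv_tgForce_coord (j i : Fin 3) (x : UnitAddTorus (Fin 3)) :
    partialDeriv j tgForce x i =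
      (∑ k ∈ tgShell, UnitAddTorus.mFourier k x * ((2 * Real.pi * Complex.I * (k j : ℂ)) * tgCoeff k i)).re := by
  rw [tgForce_eq_realTrigPoly, partialDeriv_realTrigPoly, realTrigPoly_apply_coord, trigPoly_apply_coord]
  simp only [PiLp.smul_apply, smul_eq_mul]

/-- `∂₀ (f_TG)₀ = 2π cos cos cos`. [folklore] -/
theorem partialDeriv_tgForce_00 (x : UnitAddTorus (Fin 3)) :
    partialDeriv 0 tgForce x 0 =
      2 * Real.pi * ((fourier 1 (x 0) : ℂ).re * (fourier 1 (x 1) : ℂ).re * (fourier 1 (x 2) : ℂ).re) := by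
  rw [partialDeriv_tgForce_coord]
  have h : ∀ k ∈ tgShell, UnitAddTorus.mFourier k x * ((2 * Real.pi * Complex.I * (k 0 : ℂ)) * tgCoeff k 0) =
      ∏ j, (![fun a : ℤ => fourier a (x 0) * (((8⁻¹ : ℝ) : ℂ) * -(Complex.I * (a : ℂ))) *
          (2 * Real.pi * Complex.I * (a : ℂ)),
        fun a : ℤ => (fourier a (x 1) : ℂ), fun a : ℤ => (fourier a (x 2) : ℂ)] : Fin 3 → ℤ → ℂ) j (k j) := by
    intro k _
    rw [mFourier_three, Fin.prod_univ_three]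
    simp [tgCoeff]
    ring
  rw [Finset.sum_congr rfl h, sum_tgShell_prod, Fin.prod_univ_three]
  simp only [Matrix.cons_val_zero, Matrix.cons_val_one, Matrix.cons_val_two, Matrix.head_cons, Matrix.tail_cons,
    fourier_neg, Int.cast_one, Int.cast_neg]
  simp only [Complex.mul_re, Complex.mul_im, Complex.add_re, Complex.add_im, Complex.neg_re, Complex.neg_im,
    Complex.conj_re, Complex.conj_im, Complex.I_re, Complex.I_im, Complex.ofReal_re, Complex.ofReal_im,
    Complex.one_re, Complex.one_im, Complex.re_ofNat, Complex.im_ofNat,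
    zero_mul, sub_zero, zero_sub, add_zero, zero_add, mul_one, one_mul, mul_zero]
  ring

/-- `∂₁ (f_TG)₀ = −2π sin sin cos`. [folklore] -/
theorem partialDeriv_tgForce_10 (x : UnitAddTorus (Fin 3)) :
    partialDeriv 1 tgForce x 0 =
      -(2 * Real.pi * ((fourier 1 (x 0) : ℂ).im * (fourier 1 (x 1) : ℂ).im * (fourier 1 (x 2) : ℂ).re)) := by
  rw [partialDeriv_tgForce_coord]
  have h : ∀ k ∈ tgShell, UnitAddTorus.mFourier k x * ((2 * Real.pi * Complex.I * (k 1 : ℂ)) * tgCoeff k 0) =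
      ∏ j, (![fun a : ℤ => fourier a (x 0) * (((8⁻¹ : ℝ) : ℂ) * -(Complex.I * (a : ℂ))),
        fun a : ℤ => (fourier a (x 1) : ℂ) * (2 * Real.pi * Complex.I * (a : ℂ)),
        fun a : ℤ => (fourier a (x 2) : ℂ)] : Fin 3 → ℤ → ℂ) j (k j) := by
    intro k _
    rw [mFourier_three, Fin.prod_univ_three]
    simp [tgCoeff]
    ring
  rw [Finset.sum_congr rfl h, sum_tgShell_prod, Fin.prod_univ_three]
  simp only [Matrix.cons_val_zero, Matrix.cons_val_one, Matrix.cons_val_two, Matrix.head_cons, Matrix.tail_cons,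
    fourier_neg, Int.cast_one, Int.cast_neg]
  simp only [Complex.mul_re, Complex.mul_im, Complex.add_re, Complex.add_im, Complex.neg_re, Complex.neg_im,
    Complex.conj_re, Complex.conj_im, Complex.I_re, Complex.I_im, Complex.ofReal_re, Complex.ofReal_im,
    Complex.one_re, Complex.one_im, Complex.re_ofNat, Complex.im_ofNat,
    zero_mul, sub_zero, zero_sub, add_zero, zero_add, mul_one, one_mul, mul_zero]
  ring

/-- `∂₂ (f_TG)₀ = −2π sin cos sin`. [folklore] -/
theorem partialDeriv_tgForce_20 (x : UnitAddTorus (Fin 3)) :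
    partialDeriv 2 tgForce x 0 =
      -(2 * Real.pi * ((fourier 1 (x 0) : ℂ).im * (fourier 1 (x 1) : ℂ).re * (fourier 1 (x 2) : ℂ).im)) := by
  rw [partialDeriv_tgForce_coord]
  have h : ∀ k ∈ tgShell, UnitAddTorus.mFourier k x * ((2 * Real.pi * Complex.I * (k 2 : ℂ)) * tgCoeff k 0) =
      ∏ j, (![fun a : ℤ => fourier a (x 0) * (((8⁻¹ : ℝ) : ℂ) * -(Complex.I * (a : ℂ))),
        fun a : ℤ => (fourier a (x 1) : ℂ),
        fun a : ℤ => (fourier a (x 2) : ℂ) * (2 * Real.pi * Complex.I * (a : ℂ))] : Fin 3 → ℤ → ℂ) j (k j) := by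
    intro k _
    rw [mFourier_three, Fin.prod_univ_three]
    simp [tgCoeff]
    ring
  rw [Finset.sum_congr rfl h, sum_tgShell_prod, Fin.prod_univ_three]
  simp only [Matrix.cons_val_zero, Matrix.cons_val_one, Matrix.cons_val_two, Matrix.head_cons, Matrix.tail_cons,
    fourier_neg, Int.cast_one, Int.cast_neg]
  simp only [Complex.mul_re, Complex.mul_im, Complex.add_re, Complex.add_im, Complex.neg_re, Complex.neg_im,
    Complex.conj_re, Complex.conj_im, Complex.I_re, Complex.I_im, Complex.ofReal_re, Complex.ofReal_im,
    Complex.one_re, Complex.one_im, Complex.re_ofNat, Complex.im_ofNat,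
    zero_mul, sub_zero, zero_sub, add_zero, zero_add, mul_one, one_mul, mul_zero]
  ring

/-- `∂₀ (f_TG)₁ = 2π sin sin cos`. [folklore] -/
theorem partialDeriv_tgForce_01 (x : UnitAddTorus (Fin 3)) :
    partialDeriv 0 tgForce x 1 =
      2 * Real.pi * ((fourier 1 (x 0) : ℂ).im * (fourier 1 (x 1) : ℂ).im * (fourier 1 (x 2) : ℂ).re) := by
  rw [partialDeriv_tgForce_coord]
  have h : ∀ k ∈ tgShell, UnitAddTorus.mFourier k x * ((2 * Real.pi * Complex.I * (k 0 : ℂ)) * tgCoeff k 1) =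
      ∏ j, (![fun a : ℤ => (fourier a (x 0) : ℂ) * (2 * Real.pi * Complex.I * (a : ℂ)),
        fun a : ℤ => fourier a (x 1) * (((8⁻¹ : ℝ) : ℂ) * (Complex.I * (a : ℂ))),
        fun a : ℤ => (fourier a (x 2) : ℂ)] : Fin 3 → ℤ → ℂ) j (k j) := by
    intro k _
    rw [mFourier_three, Fin.prod_univ_three]
    simp [tgCoeff]
    ring
  rw [Finset.sum_congr rfl h, sum_tgShell_prod, Fin.prod_univ_three]
  simp only [Matrix.cons_val_zero, Matrix.cons_val_one, Matrix.cons_val_two, Matrix.head_cons, Matrix.tail_cons,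
    fourier_neg, Int.cast_one, Int.cast_neg]
  simp only [Complex.mul_re, Complex.mul_im, Complex.add_re, Complex.add_im, Complex.neg_re, Complex.neg_im,
    Complex.conj_re, Complex.conj_im, Complex.I_re, Complex.I_im, Complex.ofReal_re, Complex.ofReal_im,
    Complex.one_re, Complex.one_im, Complex.re_ofNat, Complex.im_ofNat,
    zero_mul, sub_zero, zero_sub, add_zero, zero_add, mul_one, one_mul, mul_zero]
  ring

/-- `∂₁ (f_TG)₁ = −2π cos cos cos`. [folklore] -/
theorem partialDeriv_tgForce_11 (x : UnitAddTorus (Fin 3)) :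
    partialDeriv 1 tgForce x 1 =
      -(2 * Real.pi * ((fourier 1 (x 0) : ℂ).re * (fourier 1 (x 1) : ℂ).re * (fourier 1 (x 2) : ℂ).re)) := by
  rw [partialDeriv_tgForce_coord]
  have h : ∀ k ∈ tgShell, UnitAddTorus.mFourier k x * ((2 * Real.pi * Complex.I * (k 1 : ℂ)) * tgCoeff k 1) =
      ∏ j, (![fun a : ℤ => (fourier a (x 0) : ℂ),
        fun a : ℤ => fourier a (x 1) * (((8⁻¹ : ℝ) : ℂ) * (Complex.I * (a : ℂ))) * (2 * Real.pi * Complex.I * (a : ℂ)),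
        fun a : ℤ => (fourier a (x 2) : ℂ)] : Fin 3 → ℤ → ℂ) j (k j) := by
    intro k _
    rw [mFourier_three, Fin.prod_univ_three]
    simp [tgCoeff]
    ring
  rw [Finset.sum_congr rfl h, sum_tgShell_prod, Fin.prod_univ_three]
  simp only [Matrix.cons_val_zero, Matrix.cons_val_one, Matrix.cons_val_two, Matrix.head_cons, Matrix.tail_cons,
    fourier_neg, Int.cast_one, Int.cast_neg]
  simp only [Complex.mul_re, Complex.mul_im, Complex.add_re, Complex.add_im, Complex.neg_re, Complex.neg_im,
    Complex.conj_re, Complex.conj_im, Complex.I_re, Complex.I_im, Complex.ofReal_re, Complex.ofReal_im,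
    Complex.one_re, Complex.one_im, Complex.re_ofNat, Complex.im_ofNat,
    zero_mul, sub_zero, zero_sub, add_zero, zero_add, mul_one, one_mul, mul_zero]
  ring

/-- `∂₂ (f_TG)₁ = 2π cos sin sin`. [folklore] -/
theorem partialDeriv_tgForce_21 (x : UnitAddTorus (Fin 3)) :
    partialDeriv 2 tgForce x 1 =
      2 * Real.pi * ((fourier 1 (x 0) : ℂ).re * (fourier 1 (x 1) : ℂ).im * (fourier 1 (x 2) : ℂ).im) := by
  rw [partialDeriv_tgForce_coord]
  have h : ∀ k ∈ tgShell, UnitAddTorus.mFourier k x * ((2 * Real.pi * Complex.I * (k 2 : ℂ)) * tgCoeff k 1) =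
      ∏ j, (![fun a : ℤ => (fourier a (x 0) : ℂ),
        fun a : ℤ => fourier a (x 1) * (((8⁻¹ : ℝ) : ℂ) * (Complex.I * (a : ℂ))),
        fun a : ℤ => (fourier a (x 2) : ℂ) * (2 * Real.pi * Complex.I * (a : ℂ))] : Fin 3 → ℤ → ℂ) j (k j) := by
    intro k _
    rw [mFourier_three, Fin.prod_univ_three]
    simp [tgCoeff]
    ring
  rw [Finset.sum_congr rfl h, sum_tgShell_prod, Fin.prod_univ_three]
  simp only [Matrix.cons_val_zero, Matrix.cons_val_one, Matrix.cons_val_two, Matrix.head_cons, Matrix.tail_cons,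
    fourier_neg, Int.cast_one, Int.cast_neg]
  simp only [Complex.mul_re, Complex.mul_im, Complex.add_re, Complex.add_im, Complex.neg_re, Complex.neg_im,
    Complex.conj_re, Complex.conj_im, Complex.I_re, Complex.I_im, Complex.ofReal_re, Complex.ofReal_im,
    Complex.one_re, Complex.one_im, Complex.re_ofNat, Complex.im_ofNat,
    zero_mul, sub_zero, zero_sub, add_zero, zero_add, mul_one, one_mul, mul_zero]
  ring

/-- `∂ⱼ (f_TG)₂ = 0` (the third component of `f_TG` vanishes). [folklore] -/
theorem partialDeriv_tgForce_j2 (j : Fin 3) (x : UnitAddTorus (Fin 3)) : partialDeriv j tgForce x 2 = 0 := by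
  rw [partialDeriv_tgForce_coord]
  simp [tgCoeff]

/-! ## §3 The quadratic form `u·∇f_TG(x)u` and its sharp bound -/

/-- `cos² + sin² = 1` for the Fourier character: `(Re e(x))² + (Im e(x))² = 1`. [folklore] -/
theorem fourier_re_sq_add_im_sq (t : UnitAddCircle) :
    ((fourier 1 t : ℂ)).re ^ 2 + ((fourier 1 t : ℂ)).im ^ 2 = 1 := by
  have h1 : ‖(fourier 1 t : ℂ)‖ = 1 := by
    rw [fourier_apply]
    exact Circle.norm_coe _
  have h2 := Complex.sq_norm (fourier 1 t : ℂ)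
  rw [h1, Complex.normSq_apply] at h2
  nlinarith [h2]

/-- **The quadratic form of the gradient of `f_TG`**:
`⟪∇f_TG(x) v, v⟫ = 2π (c₀c₁c₂ (v₀² − v₁²) − s₀c₁s₂ v₀v₂ + c₀s₁s₂ v₁v₂)` with `cᵢ = cos 2πxᵢ`,
`sᵢ = sin 2πxᵢ`. [folklore] -/
theorem inner_fderiv_tgForce_apply (x : UnitAddTorus (Fin 3)) (v : EuclideanSpace ℝ (Fin 3)) :
    ⟪Torus.fderiv tgForce x v, v⟫_ℝ =
      2 * Real.pi * (((fourier 1 (x 0) : ℂ).re * (fourier 1 (x 1) : ℂ).re * (fourier 1 (x 2) : ℂ).re) *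
          (v 0 ^ 2 - v 1 ^ 2) -
        ((fourier 1 (x 0) : ℂ).im * (fourier 1 (x 1) : ℂ).re * (fourier 1 (x 2) : ℂ).im) * v 0 * v 2 +
        ((fourier 1 (x 0) : ℂ).re * (fourier 1 (x 1) : ℂ).im * (fourier 1 (x 2) : ℂ).im) * v 1 * v 2) := by
  rw [fderiv_apply_eq_sum_partialDeriv (isSmooth_tgForce.isContDiff (by simp)), sum_inner, Fin.sum_univ_three]
  simp only [inner_smul_left, RCLike.conj_to_real]
  have hin : ∀ j : Fin 3, ⟪partialDeriv j tgForce x, v⟫_ℝ =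
      partialDeriv j tgForce x 0 * v 0 + partialDeriv j tgForce x 1 * v 1 + partialDeriv j tgForce x 2 * v 2 := by
    intro j
    rw [EuclideanSpace.inner_eq_star_dotProduct, dotProduct, Fin.sum_univ_three]
    simp only [star_trivial]
    ring
  simp only [hin, partialDeriv_tgForce_00, partialDeriv_tgForce_10, partialDeriv_tgForce_20, partialDeriv_tgForce_01,
    partialDeriv_tgForce_11, partialDeriv_tgForce_21, partialDeriv_tgForce_j2]
  ring

/-- **The sharp pointwise stress bound**: `|⟪∇f_TG(x) v, v⟫| ≤ 2π ‖v‖²` for all `x ∈ T³`, `v ∈ ℝ³`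
(equality approached along `v = e₁` at the stagnation point `x = 0`). [folklore] -/
theorem abs_inner_fderiv_tgForce_apply_le (x : UnitAddTorus (Fin 3)) (v : EuclideanSpace ℝ (Fin 3)) :
    |⟪Torus.fderiv tgForce x v, v⟫_ℝ| ≤ 2 * Real.pi * ‖v‖ ^ 2 := by
  rw [inner_fderiv_tgForce_apply, abs_mul, abs_of_pos Real.two_pi_pos, EuclideanSpace.real_norm_sq_eq,
    Fin.sum_univ_three]
  refine mul_le_mul_of_nonneg_left ?_ Real.two_pi_pos.le
  have h := tg_quadratic_form_abs_le ((fourier 1 (x 0) : ℂ)).re ((fourier 1 (x 0) : ℂ)).im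
    ((fourier 1 (x 1) : ℂ)).re ((fourier 1 (x 1) : ℂ)).im ((fourier 1 (x 2) : ℂ)).re ((fourier 1 (x 2) : ℂ)).im
    (v 0) (v 1) (v 2) (fourier_re_sq_add_im_sq (x 0)) (fourier_re_sq_add_im_sq (x 1)) (fourier_re_sq_add_im_sq (x 2))
  convert h using 2


/-! ## §4 The sharp Reynolds-stress bound on `L²`: `|I_{f_TG}(u)| ≤ 2π |u|²` -/

/-- **Sharp anti-pumping stress bound.** For every `u ∈ L²(T³; ℝ³)`:
`|I_{f_TG}(u)| = |∫ u·∇f_TG u| ≤ 2π ∫|u|² = 2π ‖u‖²`. The constant `2π = max_x ‖Def f_TG(x)‖_op` is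
attained at the eight stagnation points `xᵢ ∈ {0, ½}` and is optimal (concentrated packets). [folklore] -/
theorem abs_inertialPairing_tgForce_le : ∀ u : Lp (EuclideanSpace ℝ (Fin 3)) 2 (volume : Measure (UnitAddTorus (Fin 3))), |Torus.inertialPairing u tgForce| ≤ 2 * Real.pi * ‖u‖ ^ 2 := by
  intro u
  have hu : MemLp (u : UnitAddTorus (Fin 3) → EuclideanSpace ℝ (Fin 3)) 2 volume := Lp.memLp u
  have hi2 : Integrable (fun x => 2 * Real.pi * ‖(u : UnitAddTorus (Fin 3) → EuclideanSpace ℝ (Fin 3)) x‖ ^ 2)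
      volume := (hu.integrable_norm_pow two_ne_zero).const_mul _
  have hpt : ∀ x, ‖⟪Torus.fderiv tgForce x ((u : UnitAddTorus (Fin 3) → EuclideanSpace ℝ (Fin 3)) x),
      (u : UnitAddTorus (Fin 3) → EuclideanSpace ℝ (Fin 3)) x⟫_ℝ‖ ≤
      2 * Real.pi * ‖(u : UnitAddTorus (Fin 3) → EuclideanSpace ℝ (Fin 3)) x‖ ^ 2 := fun x => by
    rw [Real.norm_eq_abs]
    exact abs_inner_fderiv_tgForce_apply_le x _
  rw [Torus.inertialPairing, ← Real.norm_eq_abs, ← Torus.integral_norm_sq_coe_eq, ← integral_const_mul]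
  exact norm_integral_le_of_norm_le hi2 (ae_of_all _ hpt)

/-- The same on `H`. [folklore] -/
theorem abs_inertialPairing_tgForce_le_energy (u : Torus.energySpace (Fin 3)) :
    |Torus.inertialPairing u.1 tgForce| ≤ 2 * Real.pi * ‖u‖ ^ 2 := by
  rw [Submodule.coe_norm]
  exact abs_inertialPairing_tgForce_le u.1


end Summit.AnomalousDissipation.AnomalousDissipation.Theorems.PumpedMirrorMirrorFloorTG

end
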